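import Mathlib.Analysis.MeanInequalitiesPow
import Mathlib.Analysis.Complex.Basic
import Mathlib.Analysis.SpecialFunctions.Exp
import Mathlib.Algebra.CharP.Two
import Mathlib.Data.ZMod.Basic
import Mathlib.FieldTheory.Finite.Basic
import Literature.Computability.MetaComplexity.SmolenskyProperty
import HarnessLib

/-!
# Viola–Wigderson: exponential sums of a low-degree `𝔽₂`-polynomial phase against `ζ^{|x|}`
# (the `Mod_m` versus degree-`d` polynomials correlation bound, `exp(-Ω(n/4^d))`)

We formalise §2 of Viola–Wigderson, *Norms, XOR lemmas, and lower bounds for polynomials and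
protocols* (Theory of Computing 4 (2008) 137–168): the "degree-`k` norm" (Gowers uniformity
functional) proof that a polynomial `P : 𝔽₂ⁿ → 𝔽₂` of degree `≤ d` has exponentially small
correlation with the characters `x ↦ ζ^{x₁ + ⋯ + xₙ}` (`ζ` a nontrivial root of unity of odd order;
these characters generate the `Mod_m` indicators), in the explicit form

  `‖2⁻ⁿ Σ_x (−1)^{P(x)} ζ^{|x|}‖ ^ (2^(d+1)) ≤ (1 − (1 − Re ζ^(2^d)) / 2^(d+1))ⁿ`     (`‖ζ‖ = 1`),

i.e. `≤ exp(−(1 − Re ζ^(2^d))·n/4^(d+1))` after taking roots — Viola–Wigderson Thm. 2.9 /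
§1.2.4 (1) "the `Mod_m` function on `n` bits has correlation at most `exp(−Ω(n/4^d))` with any
polynomial over GF(2) of degree `d`" (first proved as `exp(−Ω(n/8^d))` by Bourgain 2005; also
Green–Roy–Straubing 2005, Chattopadhyay 2007).

Architecture (following the printed proof):

* `gowersU k f` — the degree-`k` functional `U_k(f)` of VW08 Def. 2.2 on a finite abelian group,
  defined RECURSIVELY: `U₀(f) = 𝔼 f`, `U_{k+1}(f) = 𝔼_y U_k(f · conj f(· + y))`; `gowersU_one`:
  `U₁(f) = |𝔼 f|²`; `U_{k+1}(f)` is a nonnegative real (`gowersU_succ_im`, `gowersU_succ_re_nonneg`).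
* `DegLE d P` — "degree `≤ d`" for `P : G → 𝔽₂` via discrete derivatives (`P` has degree `≤ d+1`
  iff every `x ↦ P(x) + P(x+y)` has degree `≤ d`), and `degLE_of_mem_lowDeg`: the tree's multilinear
  degree filtration `Smolensky.lowDeg (ZMod 2) n d` (file `SmolenskyProperty.lean`) implies `DegLE d`
  (the derivative of a monomial of degree `d+1` has degree `≤ d`, `derivXor_mem_lowDeg`).
* `norm_avg_mul_signChar_pow_le` — VW08 Lemma 2.3 in the form
  `‖𝔼_x f(x)(−1)^{P(x)}‖^(2^(d+1)) ≤ U_{d+1}(f)` for `DegLE d P` (one Cauchy–Schwarz step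
  `|𝔼 g|² = 𝔼_y 𝔼_x g(x) conj g(x+y)` per degree, then convexity of `t ↦ t^(2^(d+1))`).
* `gowersU_pi` — VW08 Fact 2.7: for a product function on `ι → H` the functional multiplies.
* `gowersU_succ_phaseFn` — the one-bit computation `U_{k+1}((1, w)) = 1 − (1 − Re w^(2^k))/2^(k+1)`
  (`‖w‖ = 1`), VW08 proof of Thm. 2.9.
* `violaWigderson_sum_bound` (on `Fin n → ZMod 2`) and `violaWigderson_cube_sum_bound` (on the
  tree's cube `Fin n → Bool`, hypothesis `P ∈ Smolensky.lowDeg (ZMod 2) n d`) — the displayed bound;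
  `violaWigderson_cube_exp_bound` — the `exp(−θ n/4^(d+1))` form; `re_pow_lt_one_of_odd_order` —
  for `ζ^m = 1`, `m` odd, `ζ ≠ 1` the base is `< 1`.

Everything is proved; no named facts. Deliberately NOT here: the distribution-`Q` normalisation of
VW08's `Cor`, general `q`-phases `e_q(P(x))` (Bourgain / Chattopadhyay; VW's method is specific to
`q = 2`), and the XOR / direct-product lemmas of VW08 §2.2.

## References

* E. Viola, A. Wigderson, *Norms, XOR lemmas, and lower bounds for polynomials and protocols*,
  Theory of Computing 4 (2008), 137–168, §2.1 (Def. 2.2, Lemma 2.3, Fact 2.7), §2.3 (Thm. 2.9,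
  Lemma 2.10) [ViolaWigderson2008].
* J. Bourgain, *Estimation of certain exponential sums arising in complexity theory*, C. R. Math.
  Acad. Sci. Paris 340 (2005), 627–631.
* F. Green, A. Roy, H. Straubing, *Bounds on an exponential sum arising in Boolean circuit
  complexity*, C. R. Math. Acad. Sci. Paris 341 (2005), 279–282.
* A. Chattopadhyay, *Discrepancy and the power of bottom fan-in in depth-three circuits*, FOCS 2007.
-/

noncomputable section

open Finset
open scoped ComplexConjugate

namespace Literature.Computability.MetaComplexity

namespace GowersCube

/-! ### The sign character of `𝔽₂` -/

/-- `χ(a) = (−1)^a ∈ ℂ` for `a ∈ 𝔽₂`. [cite: ViolaWigderson2008, §2 (polynomials as maps to {−1,1})] -/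
def signChar (a : ZMod 2) : ℂ := if a = 0 then 1 else -1

/-- `𝔽₂ = {0, 1}`. [folklore] -/
private theorem zmod2_cases (a : ZMod 2) : a = 0 ∨ a = 1 :=
  (by decide : ∀ a : ZMod 2, a = 0 ∨ a = 1) a

/-- `1 + 1 = 0` in `𝔽₂`. [folklore] -/
private theorem one_add_one_zmod2 : (1 : ZMod 2) + 1 = 0 := by decide

/-- `1 ≠ 0` in `𝔽₂`. [folklore] -/
private theorem one_ne_zero_zmod2 : (1 : ZMod 2) ≠ 0 := by decide

/-- `χ(0) = 1`. [cite: ViolaWigderson2008, §2 (polynomials over GF(2) as maps to {−1,1}; product = XOR)] -/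
@[simp] theorem signChar_zero : signChar 0 = 1 := by simp [signChar]

/-- `χ(1) = −1`. [cite: ViolaWigderson2008, §2 (polynomials over GF(2) as maps to {−1,1}; product = XOR)] -/
@[simp] theorem signChar_one : signChar 1 = -1 := if_neg one_ne_zero_zmod2

/-- `χ` is a character: `χ(a+b) = χ(a)χ(b)` ("a product of functions is equivalent to their
exclusive-or in the 0/1 notation"). [cite: ViolaWigderson2008, §2 (polynomials over GF(2) as maps to {−1,1}; product = XOR)] -/
theorem signChar_add (a b : ZMod 2) : signChar (a + b) = signChar a * signChar b := by
  rcases zmod2_cases a with rfl | rfl <;> rcases zmod2_cases b with rfl | rfl <;>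
    simp [one_add_one_zmod2]

/-- `χ` is real: `conj χ(a) = χ(a)`. [cite: ViolaWigderson2008, §2 (polynomials over GF(2) as maps to {−1,1}; product = XOR)] -/
@[simp] theorem conj_signChar (a : ZMod 2) : conj (signChar a) = signChar a := by
  rcases zmod2_cases a with rfl | rfl <;> simp

/-- `‖χ(a)‖ = 1`. [cite: ViolaWigderson2008, §2 (polynomials over GF(2) as maps to {−1,1}; product = XOR)] -/
@[simp] theorem norm_signChar (a : ZMod 2) : ‖signChar a‖ = 1 := by
  rcases zmod2_cases a with rfl | rfl <;> simp

/-! ### Averages and the degree-`k` functional on a finite abelian group -/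

section Avg

variable {G : Type*} [Fintype G]

/-- The average `𝔼_x f(x) = |G|⁻¹ Σ_x f(x)`. [folklore] -/
def avg (f : G → ℂ) : ℂ := (∑ x, f x) / (Fintype.card G : ℂ)

/-- Real part of an average. [folklore] -/
private theorem avg_re (f : G → ℂ) : (avg f).re = (∑ x, (f x).re) / Fintype.card G := by
  rw [avg, Complex.div_natCast_re, Complex.re_sum]

/-- Imaginary part of an average. [folklore] -/
private theorem avg_im (f : G → ℂ) : (avg f).im = (∑ x, (f x).im) / Fintype.card G := by
  rw [avg, Complex.div_natCast_im, Complex.im_sum]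

/-- Averages are linear in scalars. [folklore] -/
private theorem avg_const_mul (c : ℂ) (f : G → ℂ) : avg (fun x => c * f x) = c * avg f := by
  rw [avg, avg, ← Finset.mul_sum, mul_div_assoc]

end Avg

section Shift

variable {G : Type*} [AddCommGroup G]

/-- The multiplicative derivative `Δ_y f (x) = f(x) · conj f(x + y)`.
[cite: ViolaWigderson2008, §2.1 (proof of Lemma 2.3)] -/
def mulShift (f : G → ℂ) (y : G) : G → ℂ := fun x => f x * conj (f (x + y))

/-- Scalars: `Δ_y (c f) = |c|² Δ_y f`. [folklore] -/
private theorem mulShift_const_mul (c : ℂ) (f : G → ℂ) (y : G) :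
    mulShift (fun x => c * f x) y = fun x => (c * conj c) * mulShift f y x := by
  funext x
  simp only [mulShift, map_mul]
  ring

end Shift

section Group

variable {G : Type*} [AddCommGroup G] [Fintype G]

/-- **The degree-`k` functional** `U_k(f)` (Viola–Wigderson Def. 2.2, "degree-`k` norm"; Gowers'
uniformity `‖f‖_{U^k}^{2^k}`), in the recursive form `U₀(f) = 𝔼 f`,
`U_{k+1}(f) = 𝔼_y U_k(Δ_y f)`; unfolding the recursion gives VW's
`𝔼_{x,y₁,…,y_k} Π_{S ⊆ [k]} conj^{|S|} f(x + Σ_{j∈S} y_j)`. [cite: ViolaWigderson2008, Definition 2.2] -/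
def gowersU : ℕ → (G → ℂ) → ℂ
  | 0 => fun f => avg f
  | k + 1 => fun f => avg fun y => gowersU k (mulShift f y)

/-- `U₀(f) = 𝔼 f`. [cite: ViolaWigderson2008, Definition 2.2] -/
@[simp] theorem gowersU_zero (f : G → ℂ) : gowersU 0 f = avg f := rfl

/-- `U_{k+1}(f) = 𝔼_y U_k(Δ_y f)`. [cite: ViolaWigderson2008, Definition 2.2] -/
theorem gowersU_succ (k : ℕ) (f : G → ℂ) :
    gowersU (k + 1) f = avg fun y => gowersU k (mulShift f y) := rfl

/-- Translation invariance of sums over the group. [folklore] -/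
private theorem sum_add_left (g : G → ℂ) (x : G) : ∑ y, g (x + y) = ∑ y, g y :=
  Fintype.sum_equiv (Equiv.addLeft x) (fun y => g (x + y)) g fun _ => rfl

/-- `U₁(f) = |𝔼 f|²` (one Cauchy–Schwarz identity: `𝔼_y 𝔼_x f(x) conj f(x+y) = 𝔼 f · conj 𝔼 f`).
[cite: ViolaWigderson2008, §2.1 (remarks after Definition 2.2)] -/
theorem gowersU_one (f : G → ℂ) : gowersU 1 f = ((‖avg f‖ ^ 2 : ℝ) : ℂ) := by
  rw [gowersU_succ]
  simp only [gowersU_zero]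
  have hN : (Fintype.card G : ℂ) ≠ 0 := Nat.cast_ne_zero.2 Fintype.card_pos.ne'
  have h1 : ∀ x : G, ∑ y, conj (f (x + y)) = conj (∑ y, f y) := fun x => by
    rw [map_sum]
    exact sum_add_left (fun y => conj (f y)) x
  have h2 : (∑ y, avg (mulShift f y)) = (∑ x, f x) * conj (∑ y, f y) / (Fintype.card G : ℂ) := by
    simp only [avg, mulShift]
    rw [← Finset.sum_div, Finset.sum_comm]
    congr 1
    rw [Finset.sum_mul]
    refine Finset.sum_congr rfl fun x _ => ?_
    rw [← Finset.mul_sum, h1 x]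
  rw [avg, h2, show (((‖avg f‖ ^ 2 : ℝ)) : ℂ) = avg f * conj (avg f) by
    rw [Complex.mul_conj, Complex.normSq_eq_norm_sq], avg, map_div₀, map_natCast]
  field_simp

/-- `U_{k+1}(f)` is real … [cite: ViolaWigderson2008, §2.1 ("it is always a non-negative real number")] -/
theorem gowersU_succ_im (k : ℕ) : ∀ f : G → ℂ, (gowersU (k + 1) f).im = 0 := by
  induction k with
  | zero => intro f; rw [gowersU_one, Complex.ofReal_im]
  | succ k ih =>
    intro f
    rw [gowersU_succ, avg_im]
    simp [ih]

/-- … and nonnegative. [cite: ViolaWigderson2008, §2.1 ("it is always a non-negative real number")] -/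
theorem gowersU_succ_re_nonneg (k : ℕ) : ∀ f : G → ℂ, 0 ≤ (gowersU (k + 1) f).re := by
  induction k with
  | zero => intro f; rw [gowersU_one, Complex.ofReal_re]; positivity
  | succ k ih =>
    intro f
    rw [gowersU_succ, avg_re]
    exact div_nonneg (Finset.sum_nonneg fun y _ => ih _) (Nat.cast_nonneg _)

/-- Homogeneity: `U_{k+1}(c f) = |c|^(2^(k+1)) U_{k+1}(f)` (the `2^k`-th root of `U_k` is a
seminorm). [cite: ViolaWigderson2008, Definition 2.2 (and the remark "cf. [38]" after it)] -/
theorem gowersU_succ_const_mul (k : ℕ) :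
    ∀ (c : ℂ) (f : G → ℂ), gowersU (k + 1) (fun x => c * f x) =
      ((‖c‖ ^ 2 ^ (k + 1) : ℝ) : ℂ) * gowersU (k + 1) f := by
  induction k with
  | zero =>
    intro c f
    rw [gowersU_one, gowersU_one, avg_const_mul, norm_mul, mul_pow, Complex.ofReal_mul]
    norm_num
  | succ k ih =>
    intro c f
    rw [gowersU_succ, gowersU_succ]
    have h : ∀ y, gowersU (k + 1) (mulShift (fun x => c * f x) y) =
        ((‖c‖ ^ 2 ^ (k + 2) : ℝ) : ℂ) * gowersU (k + 1) (mulShift f y) := by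
      intro y
      rw [mulShift_const_mul, ih]
      congr 2
      rw [norm_mul, Complex.norm_conj, ← pow_two, ← pow_mul, ← pow_succ']
    simp_rw [h]
    rw [avg_const_mul]

/-! ### Degree via discrete derivatives and the main inequality (VW08 Lemma 2.3) -/

/-- "`P` has degree `≤ d`" for `P : G → 𝔽₂`, by discrete derivatives: degree `≤ 0` means constant,
degree `≤ d+1` means every derivative `x ↦ P(x) + P(x + y)` has degree `≤ d`. For `G = 𝔽₂ⁿ` this is
the usual polynomial degree (`degLE_of_mem_lowDeg` below gives the direction used here).
[cite: ViolaWigderson2008, §2.1 (proof of Lemma 2.3: "p(x)·p(x+y) has degree d−1")] -/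
def DegLE {G : Type*} [Add G] : ℕ → (G → ZMod 2) → Prop
  | 0 => fun P => ∀ x y, P x = P y
  | d + 1 => fun P => ∀ y, DegLE d fun x => P x + P (x + y)

/-- Unfolding `DegLE 0`. [folklore] -/
private theorem degLE_zero_iff {G' : Type*} [Add G'] (P : G' → ZMod 2) : DegLE 0 P ↔ ∀ x y, P x = P y :=
  Iff.rfl

/-- Unfolding `DegLE (d+1)`. [folklore] -/
private theorem degLE_succ_iff {G' : Type*} [Add G'] (d : ℕ) (P : G' → ZMod 2) :
    DegLE (d + 1) P ↔ ∀ y, DegLE d fun x => P x + P (x + y) := Iff.rfl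

/-- The weights `|G|⁻¹` sum to `1`. [folklore] -/
private theorem sum_inv_card : ∑ _y : G, (Fintype.card G : ℝ)⁻¹ = 1 := by
  rw [Finset.sum_const, Finset.card_univ, nsmul_eq_mul,
    mul_inv_cancel₀ (Nat.cast_ne_zero.2 Fintype.card_pos.ne')]

/-- **Viola–Wigderson Lemma 2.3 (the degree norm bounds correlation with low-degree polynomials)**,
in the form `‖𝔼_x f(x)(−1)^{P(x)}‖^(2^(d+1)) ≤ U_{d+1}(f)` for every `f : G → ℂ` and every `P` of
degree `≤ d` (VW: `Cor(f, p) ≤ U_{d+1}(f)^{1/2^{d+1}}`; implicit in Gowers and Green–Tao). Proof as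
printed: `|𝔼 g|² = 𝔼_y 𝔼_x g(x) conj g(x+y)`, the derivative of `(−1)^P` is `(−1)^{P(x)+P(x+y)}`
of degree one less, induction, and convexity of `t ↦ t^(2^(d+1))`.
[cite: ViolaWigderson2008, Lemma 2.3] -/
theorem norm_avg_mul_signChar_pow_le (d : ℕ) :
    ∀ (f : G → ℂ) (P : G → ZMod 2), DegLE d P →
      ‖avg fun x => f x * signChar (P x)‖ ^ 2 ^ (d + 1) ≤ (gowersU (d + 1) f).re := by
  induction d with
  | zero =>
    intro f P hP
    have hc : (fun x => f x * signChar (P x)) = fun x => signChar (P 0) * f x :=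
      funext fun x => by rw [(degLE_zero_iff P).1 hP x 0, mul_comm]
    rw [hc, avg_const_mul, norm_mul, norm_signChar, one_mul, zero_add, pow_one, gowersU_one,
      Complex.ofReal_re]
  | succ d ih =>
    intro f P hP
    set g : G → ℂ := fun x => f x * signChar (P x) with hg
    have hms : ∀ y, mulShift g y = fun x => mulShift f y x * signChar (P x + P (x + y)) := by
      intro y
      funext x
      simp only [hg, mulShift, map_mul, conj_signChar, signChar_add]
      ring
    have hIH : ∀ y, ‖avg (mulShift g y)‖ ^ 2 ^ (d + 1) ≤ (gowersU (d + 1) (mulShift f y)).re :=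
      fun y => by
        rw [hms y]
        exact ih (mulShift f y) (fun x => P x + P (x + y)) ((degLE_succ_iff d P).1 hP y)
    have hN : (0 : ℝ) < Fintype.card G := Nat.cast_pos.2 Fintype.card_pos
    have h1 : ‖avg g‖ ^ 2 ≤ (∑ y, ‖avg (mulShift g y)‖) / Fintype.card G := by
      have e : ‖avg g‖ ^ 2 = (∑ y, (avg (mulShift g y)).re) / Fintype.card G := by
        have := congrArg Complex.re (gowersU_one g)
        rw [Complex.ofReal_re] at this
        rw [← this, gowersU_succ, avg_re]
        rfl
      rw [e]
      exact div_le_div_of_nonneg_right (Finset.sum_le_sum fun y _ => Complex.re_le_norm _)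
        hN.le
    calc ‖avg g‖ ^ 2 ^ (d + 2)
        = (‖avg g‖ ^ 2) ^ 2 ^ (d + 1) := by rw [← pow_mul, ← pow_succ']
      _ ≤ ((∑ y, ‖avg (mulShift g y)‖) / Fintype.card G) ^ 2 ^ (d + 1) :=
          pow_le_pow_left₀ (sq_nonneg _) h1 _
      _ = (∑ y, (Fintype.card G : ℝ)⁻¹ * ‖avg (mulShift g y)‖) ^ 2 ^ (d + 1) := by
          rw [← Finset.mul_sum, div_eq_inv_mul]
      _ ≤ ∑ y, (Fintype.card G : ℝ)⁻¹ * ‖avg (mulShift g y)‖ ^ 2 ^ (d + 1) :=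
          Real.pow_arith_mean_le_arith_mean_pow _ _ _ (fun _ _ => by positivity) sum_inv_card
            (fun _ _ => norm_nonneg _) _
      _ ≤ ∑ y, (Fintype.card G : ℝ)⁻¹ * (gowersU (d + 1) (mulShift f y)).re :=
          Finset.sum_le_sum fun y _ => mul_le_mul_of_nonneg_left (hIH y) (by positivity)
      _ = (gowersU (d + 2) f).re := by
          rw [← Finset.mul_sum, ← div_eq_inv_mul, gowersU_succ, avg_re]

end Group

/-! ### Product functions (VW08 Fact 2.7) -/

section Pi

variable {ι : Type*} [Fintype ι] [DecidableEq ι] {H : Type*} [Fintype H]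

/-- The average of a product of one-variable functions over `ι → H` is the product of the averages
(independence of the coordinates). [folklore] -/
private theorem avg_pi_prod (g : ι → H → ℂ) : avg (fun y : ι → H => ∏ i, g i (y i)) = ∏ i, avg (g i) := by
  simp only [avg]
  have hsum : (∑ x : ι → H, ∏ i, g i (x i)) = ∏ i, ∑ h, g i h := by
    rw [Finset.prod_univ_sum, Fintype.piFinset_univ]
  rw [Fintype.card_pi, Nat.cast_prod, hsum, ← Finset.prod_div_distrib]

variable [AddCommGroup H]

/-- **The degree-`k` functional of a product function multiplies** (Viola–Wigderson Fact 2.7: "the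
norm of the product of functions on disjoint input bits multiplies"): for `F(z) = Π_i φ_i(z_i)` on
`ι → H`, `U_k(F) = Π_i U_k(φ_i)`. [cite: ViolaWigderson2008, Fact 2.7] -/
theorem gowersU_pi (k : ℕ) :
    ∀ φ : ι → H → ℂ, gowersU k (fun z : ι → H => ∏ i, φ i (z i)) = ∏ i, gowersU k (φ i) := by
  induction k with
  | zero => intro φ; exact avg_pi_prod φ
  | succ k ih =>
    intro φ
    rw [gowersU_succ]
    have h : ∀ y : ι → H, mulShift (fun z : ι → H => ∏ i, φ i (z i)) y =
        fun z => ∏ i, mulShift (φ i) (y i) (z i) := by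
      intro y
      funext z
      simp only [mulShift, Pi.add_apply, map_prod, ← Finset.prod_mul_distrib]
    simp_rw [h, ih]
    exact avg_pi_prod (fun i h' => gowersU k (mulShift (φ i) h'))

end Pi

/-! ### The one-bit computation (VW08, proof of Theorem 2.9) -/

section OneBit

/-- The one-bit phase function `(1, w)`: `a ↦ 1` if `a = 0`, `w` if `a = 1`; for `w = e_m(a)` this is
VW's `e_m^a` on one bit. [cite: ViolaWigderson2008, §2.3 (proof of Theorem 2.9)] -/
def phaseFn (w : ℂ) : ZMod 2 → ℂ := fun a => if a = 0 then 1 else w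

/-- `(1,w)(0) = 1`. [folklore] -/
@[simp] private theorem phaseFn_zero (w : ℂ) : phaseFn w 0 = 1 := by simp [phaseFn]

/-- `(1,w)(1) = w`. [folklore] -/
@[simp] private theorem phaseFn_one (w : ℂ) : phaseFn w 1 = w := if_neg one_ne_zero_zmod2

/-- `𝔽₂ = {0, 1}` as a `Finset`. [folklore] -/
private theorem univ_zmod2 : (Finset.univ : Finset (ZMod 2)) = {0, 1} := by decide

/-- Averages over `𝔽₂`. [folklore] -/
private theorem avg_zmod2 (g : ZMod 2 → ℂ) : avg g = (g 0 + g 1) / 2 := by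
  rw [avg, univ_zmod2, Finset.sum_pair (by decide : (0 : ZMod 2) ≠ 1), ZMod.card]
  norm_num

/-- `Δ₀ (1,w) = (1,1)` for `‖w‖ = 1`. [folklore] -/
private theorem mulShift_phaseFn_zero {w : ℂ} (hw : ‖w‖ = 1) : mulShift (phaseFn w) 0 = phaseFn 1 := by
  funext a
  rcases zmod2_cases a with rfl | rfl
  · simp [mulShift]
  · simp only [mulShift, add_zero, phaseFn_one, Complex.mul_conj, Complex.normSq_eq_norm_sq, hw]
    norm_num

/-- `Δ₁ (1,w) = conj w · (1, w²)` for `‖w‖ = 1`. [folklore] -/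
private theorem mulShift_phaseFn_one {w : ℂ} (hw : ‖w‖ = 1) :
    mulShift (phaseFn w) 1 = fun a => conj w * phaseFn (w ^ 2) a := by
  funext a
  rcases zmod2_cases a with rfl | rfl
  · simp [mulShift]
  · simp only [mulShift, one_add_one_zmod2, phaseFn_one, phaseFn_zero, map_one, mul_one]
    rw [pow_two, ← mul_assoc, Complex.conj_mul', hw]
    norm_num

/-- **The one-bit degree norm** (Viola–Wigderson, proof of Thm. 2.9: the norm of `e_m^a` on one bit
is bounded away from `1` by `Ω(2^{−k})` because `m` is odd): for `‖w‖ = 1`,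
`U_{k+1}((1,w)) = 1 − (1 − Re w^(2^k)) / 2^(k+1)` exactly. [cite: ViolaWigderson2008, Theorem 2.9 (proof)] -/
theorem gowersU_succ_phaseFn (k : ℕ) :
    ∀ w : ℂ, ‖w‖ = 1 → gowersU (k + 1) (phaseFn w) =
      ((1 - (1 - (w ^ 2 ^ k).re) / 2 ^ (k + 1) : ℝ) : ℂ) := by
  induction k with
  | zero =>
    intro w hw
    rw [gowersU_one, avg_zmod2, phaseFn_zero, phaseFn_one]
    congr 1
    have hre : w.re ^ 2 + w.im ^ 2 = 1 := by
      have := Complex.sq_norm w  -- ‖w‖^2 = normSq w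
      rw [hw, Complex.normSq_apply] at this
      nlinarith [this]
    rw [Complex.norm_div, Complex.norm_two, div_pow, Complex.sq_norm, Complex.normSq_apply]
    simp only [Complex.add_re, Complex.one_re, Complex.add_im, Complex.one_im, pow_zero, pow_one]
    nlinarith [hre]
  | succ k ih =>
    intro w hw
    rw [gowersU_succ, avg_zmod2, mulShift_phaseFn_zero hw, mulShift_phaseFn_one hw,
      ih 1 (by simp), gowersU_succ_const_mul, ih (w ^ 2) (by simp [hw]), Complex.norm_conj, hw]
    have e : (w ^ 2) ^ 2 ^ k = w ^ 2 ^ (k + 1) := by rw [← pow_mul, ← pow_succ']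
    rw [e]
    push_cast
    simp only [Complex.one_re, Complex.ofReal_one, one_pow, one_mul, sub_self, zero_div, sub_zero]
    ring

end OneBit

/-! ### Assembly on `𝔽₂ⁿ` (VW08 Theorem 2.9) -/

section Cube

variable {n : ℕ}

/-- The number of nonzero coordinates of `z ∈ 𝔽₂ⁿ`. [folklore] -/
def weight (z : Fin n → ZMod 2) : ℕ := (univ.filter fun i => z i ≠ 0).card

/-- `Π_i (1,ζ)(z_i) = ζ^{wt z}`. [folklore] -/
private theorem prod_phaseFn_eq_pow (ζ : ℂ) (z : Fin n → ZMod 2) : ∏ i, phaseFn ζ (z i) = ζ ^ weight z := by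
  simp only [phaseFn]
  rw [Finset.prod_ite, Finset.prod_const_one, one_mul, Finset.prod_const]
  rfl

/-- `|𝔽₂ⁿ| = 2ⁿ`. [folklore] -/
private theorem card_cube : Fintype.card (Fin n → ZMod 2) = 2 ^ n := by
  rw [Fintype.card_fun, ZMod.card, Fintype.card_fin]

/-- **Viola–Wigderson Theorem 2.9, explicit form on `𝔽₂ⁿ`.** For `P : 𝔽₂ⁿ → 𝔽₂` of degree `≤ d`
(`DegLE d P`) and any `ζ ∈ ℂ` with `‖ζ‖ = 1`:
`‖2⁻ⁿ Σ_z (−1)^{P(z)} ζ^{wt z}‖^(2^(d+1)) ≤ (1 − (1 − Re ζ^(2^d))/2^(d+1))ⁿ`.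
(Lemma 2.3 with `f(z) = ζ^{wt z} = Π_i (1,ζ)(z_i)`, Fact 2.7, and the one-bit computation.)
[cite: ViolaWigderson2008, Theorem 2.9] -/
theorem violaWigderson_sum_bound {d : ℕ} {P : (Fin n → ZMod 2) → ZMod 2} (hP : DegLE d P)
    {ζ : ℂ} (hζ : ‖ζ‖ = 1) :
    ‖(∑ z : Fin n → ZMod 2, signChar (P z) * ζ ^ weight z) / 2 ^ n‖ ^ 2 ^ (d + 1) ≤
      (1 - (1 - (ζ ^ 2 ^ d).re) / 2 ^ (d + 1)) ^ n := by
  have hmain := norm_avg_mul_signChar_pow_le d (fun z : Fin n → ZMod 2 => ∏ i, phaseFn ζ (z i)) P hP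
  have havg : avg (fun z : Fin n → ZMod 2 => (∏ i, phaseFn ζ (z i)) * signChar (P z)) =
      (∑ z : Fin n → ZMod 2, signChar (P z) * ζ ^ weight z) / 2 ^ n := by
    rw [avg, card_cube]
    push_cast
    congr 1
    exact Finset.sum_congr rfl fun z _ => by rw [prod_phaseFn_eq_pow, mul_comm]
  rw [havg, gowersU_pi, Finset.prod_const, Finset.card_univ, Fintype.card_fin,
    gowersU_succ_phaseFn d ζ hζ, ← Complex.ofReal_pow, Complex.ofReal_re] at hmain
  exact hmain

end Cube

/-! ### The tree's cube `{0,1}ⁿ` and its multilinear degree filtration -/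

section Bridge

open Smolensky

variable {n : ℕ}

/-- Coordinatewise XOR on the cube. [folklore] -/
def xorShift (x y : Fin n → Bool) : Fin n → Bool := fun i => xor (x i) (y i)

/-- `{0,1} ↪ 𝔽₂`. [folklore] -/
def bit (b : Bool) : ZMod 2 := if b then 1 else 0

/-- `[x ⊕ y] = [x] + [y]` in `𝔽₂`. [folklore] -/
private theorem bit_xor (a b : Bool) : bit (xor a b) = bit a + bit b := by
  cases a <;> cases b <;> simp [bit, one_add_one_zmod2]

/-- A monomial after a XOR-shift: `x_S(x ⊕ y) = Σ_{T ⊆ S} (Π_{i ∈ S∖T} [y_i]) · x_T(x)` over `𝔽₂`.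
[folklore] -/
private theorem mono_xorShift (S : Finset (Fin n)) (y x : Fin n → Bool) :
    mono (ZMod 2) S (xorShift x y) =
      ∑ T ∈ S.powerset, (∏ i ∈ S \ T, bit (y i)) * mono (ZMod 2) T x := by
  have h : ∀ i, (if xorShift x y i then (1 : ZMod 2) else 0) =
      (if x i then (1 : ZMod 2) else 0) + bit (y i) := by
    intro i
    have := bit_xor (x i) (y i)
    simp only [bit, xorShift] at this ⊢
    exact this
  simp only [mono, h]
  rw [Finset.prod_add]
  exact Finset.sum_congr rfl fun T _ => by rw [mul_comm]

/-- **Discrete derivatives lower the degree**: for `P` of degree `≤ d+1` on the cube and any shift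
`y`, `x ↦ P(x) + P(x ⊕ y)` has degree `≤ d` (over `𝔽₂`; the top monomials cancel).
[cite: ViolaWigderson2008, §2.1 (proof of Lemma 2.3)] -/
theorem derivXor_mem_lowDeg {d : ℕ} {P : CubeFn (ZMod 2) n} (hP : P ∈ lowDeg (ZMod 2) n (d + 1))
    (y : Fin n → Bool) : (fun x => P x + P (xorShift x y)) ∈ lowDeg (ZMod 2) n d := by
  -- the derivative as a linear map
  let L : CubeFn (ZMod 2) n →ₗ[ZMod 2] CubeFn (ZMod 2) n :=
    { toFun := fun Q x => Q x + Q (xorShift x y)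
      map_add' := fun Q R => by funext x; simp only [Pi.add_apply]; ring
      map_smul' := fun c Q => by funext x; simp only [Pi.smul_apply, smul_eq_mul, RingHom.id_apply]; ring }
  have hle : lowDeg (ZMod 2) n (d + 1) ≤ (lowDeg (ZMod 2) n d).comap L := by
    rw [lowDeg_eq_span (D := d + 1), Submodule.span_le]
    rintro _ ⟨⟨S, hS⟩, rfl⟩
    rw [SetLike.mem_coe, Submodule.mem_comap]
    change (fun x => mono (ZMod 2) S x + mono (ZMod 2) S (xorShift x y)) ∈ lowDeg (ZMod 2) n d
    have hfun : (fun x => mono (ZMod 2) S x + mono (ZMod 2) S (xorShift x y)) =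
        ∑ T ∈ S.powerset.erase S, (∏ i ∈ S \ T, bit (y i)) • mono (ZMod 2) T := by
      funext x
      rw [mono_xorShift, ← Finset.add_sum_erase _ _ (Finset.mem_powerset_self S), Finset.sdiff_self,
        Finset.prod_empty, one_mul, ← add_assoc, CharTwo.add_self_eq_zero, zero_add,
        Finset.sum_apply]
      exact Finset.sum_congr rfl fun T _ => rfl
    rw [hfun]
    refine Submodule.sum_mem _ fun T hT => Submodule.smul_mem _ _ (mono_mem_lowDeg ?_)
    have hT' := Finset.mem_erase.1 hT
    have hTS : T ⊂ S := lt_of_le_of_ne (Finset.mem_powerset.1 hT'.2) hT'.1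
    have := Finset.card_lt_card hTS
    omega
  exact hle hP

/-- Degree `≤ 0` functions on the cube are constant. [folklore] -/
private theorem const_of_mem_lowDeg_zero {F : Type*} [Field F] {P : CubeFn F n} (hP : P ∈ lowDeg F n 0)
    (x y : Fin n → Bool) : P x = P y := by
  rw [lowDeg_eq_span] at hP
  induction hP using Submodule.span_induction generalizing x y with
  | mem Q h =>
    obtain ⟨⟨S, hS⟩, rfl⟩ := h
    have hS0 : S = ∅ := Finset.card_eq_zero.1 (Nat.le_zero.1 hS)
    simp [hS0]
  | zero => rfl
  | add Q R _ _ hQ hR => simp only [Pi.add_apply, hQ x y, hR x y]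
  | smul c Q _ hQ => simp only [Pi.smul_apply, hQ x y]

/-- `𝔽₂ⁿ → {0,1}ⁿ`. [folklore] -/
def cubeOf (z : Fin n → ZMod 2) : Fin n → Bool := fun i => decide (z i ≠ 0)

/-- `cubeOf` turns addition into XOR. [folklore] -/
private theorem cubeOf_add (z w : Fin n → ZMod 2) : cubeOf (z + w) = xorShift (cubeOf z) (cubeOf w) := by
  funext i
  simp only [cubeOf, xorShift, Pi.add_apply]
  exact (by decide : ∀ a b : ZMod 2, decide (a + b ≠ 0) = xor (decide (a ≠ 0)) (decide (b ≠ 0)))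
    (z i) (w i)

/-- **The multilinear degree filtration implies the derivative degree**: `P ∈ lowDeg 𝔽₂ n d` gives
`DegLE d (P ∘ cubeOf)` (iterating "the derivative has degree one less").
[cite: ViolaWigderson2008, §2.1 (proof of Lemma 2.3)] -/
theorem degLE_of_mem_lowDeg {d : ℕ} : ∀ {P : CubeFn (ZMod 2) n}, P ∈ lowDeg (ZMod 2) n d →
    DegLE d (fun z : Fin n → ZMod 2 => P (cubeOf z)) := by
  induction d with
  | zero => intro P hP; exact fun z w => const_of_mem_lowDeg_zero hP _ _
  | succ d ih =>
    intro P hP y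
    have h := ih (derivXor_mem_lowDeg hP (cubeOf y))
    have hfun : (fun z : Fin n → ZMod 2 => P (cubeOf z) + P (cubeOf (z + y))) =
        fun z => (fun x => P x + P (xorShift x (cubeOf y))) (cubeOf z) := by
      funext z; rw [cubeOf_add]
    rw [hfun]
    exact h

/-- `{0,1}ⁿ ≃ 𝔽₂ⁿ`. [folklore] -/
def cubeEquiv : (Fin n → Bool) ≃ (Fin n → ZMod 2) where
  toFun x i := bit (x i)
  invFun := cubeOf
  left_inv x := by
    funext i
    cases h : x i <;> simp [cubeOf, bit, h]
  right_inv z := by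
    funext i
    simp only [cubeOf, bit]
    rcases zmod2_cases (z i) with h | h <;> simp [h]

/-- The weight of the image is the number of `true` coordinates. [folklore] -/
private theorem weight_cubeEquiv (x : Fin n → Bool) :
    weight (cubeEquiv x) = (univ.filter fun i => x i = true).card := by
  unfold weight
  congr 1
  ext i
  simp only [Finset.mem_filter, Finset.mem_univ, true_and, cubeEquiv, Equiv.coe_fn_mk, bit]
  cases x i <;> simp

/-- **Viola–Wigderson Theorem 2.9 in the tree's vocabulary.** For a multilinear polynomial function
`P : {0,1}ⁿ → 𝔽₂` of degree `≤ d` (`P ∈ Smolensky.lowDeg (ZMod 2) n d`, the degree filtration of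
`SmolenskyProperty.lean`, which is what `razborov_smolensky` produces for `AC⁰[2]` circuits) and
`ζ ∈ ℂ`, `‖ζ‖ = 1`:
`‖2⁻ⁿ Σ_x (−1)^{P(x)} ζ^{|x|}‖^(2^(d+1)) ≤ (1 − (1 − Re ζ^(2^d))/2^(d+1))ⁿ`, `|x| = #{i : xᵢ = 1}`.
[cite: ViolaWigderson2008, Theorem 2.9] -/
theorem violaWigderson_cube_sum_bound {d : ℕ} {P : CubeFn (ZMod 2) n}
    (hP : P ∈ lowDeg (ZMod 2) n d) {ζ : ℂ} (hζ : ‖ζ‖ = 1) :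
    ‖(∑ x : Fin n → Bool, signChar (P x) * ζ ^ (univ.filter fun i => x i = true).card) / 2 ^ n‖
        ^ 2 ^ (d + 1) ≤ (1 - (1 - (ζ ^ 2 ^ d).re) / 2 ^ (d + 1)) ^ n := by
  have h := violaWigderson_sum_bound (degLE_of_mem_lowDeg hP) hζ
  have hsum : (∑ x : Fin n → Bool, signChar (P x) * ζ ^ (univ.filter fun i => x i = true).card) =
      ∑ z : Fin n → ZMod 2, signChar (P (cubeOf z)) * ζ ^ weight z := by
    refine Fintype.sum_equiv cubeEquiv _ _ fun x => ?_
    rw [weight_cubeEquiv]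
    congr 2
    exact congrArg P (cubeEquiv.left_inv x).symm
  rw [hsum]
  exact h

/-- **The `exp(−Ω(n/4^d))` form.** Under the same hypotheses, with `θ = 1 − Re ζ^(2^d)`:
`‖2⁻ⁿ Σ_x (−1)^{P(x)} ζ^{|x|}‖ ≤ exp(−θ·n / 4^(d+1))` (from `(1 − θ/2^(d+1))ⁿ ≤ exp(−θ n/2^(d+1))`
and taking `2^(d+1)`-th roots). [cite: ViolaWigderson2008, Theorem 2.9] -/
theorem violaWigderson_cube_exp_bound {d : ℕ} {P : CubeFn (ZMod 2) n}
    (hP : P ∈ lowDeg (ZMod 2) n d) {ζ : ℂ} (hζ : ‖ζ‖ = 1) :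
    ‖(∑ x : Fin n → Bool, signChar (P x) * ζ ^ (univ.filter fun i => x i = true).card) / 2 ^ n‖ ≤
      Real.exp (-((1 - (ζ ^ 2 ^ d).re) * n / 4 ^ (d + 1))) := by
  set A := ‖(∑ x : Fin n → Bool, signChar (P x) * ζ ^ (univ.filter fun i => x i = true).card) /
    2 ^ n‖ with hA
  set θ : ℝ := 1 - (ζ ^ 2 ^ d).re with hθ
  have h := violaWigderson_cube_sum_bound hP hζ
  have hN : (0 : ℝ) < 2 ^ (d + 1) := by positivity
  -- (1 - θ/N)^n ≤ exp(-θ/N)^n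
  have hθnn : 0 ≤ θ := by
    have : (ζ ^ 2 ^ d).re ≤ ‖ζ ^ 2 ^ d‖ := Complex.re_le_norm _
    rw [norm_pow, hζ, one_pow] at this
    linarith
  have hbase : 1 - θ / 2 ^ (d + 1) ≤ Real.exp (-(θ / 2 ^ (d + 1))) := by
    have := Real.add_one_le_exp (-(θ / 2 ^ (d + 1)))
    linarith
  have hbase0 : 0 ≤ 1 - θ / 2 ^ (d + 1) := by
    have : θ ≤ 2 := by
      have : -‖ζ ^ 2 ^ d‖ ≤ (ζ ^ 2 ^ d).re := (abs_le.1 (Complex.abs_re_le_norm _)).1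
      rw [norm_pow, hζ, one_pow] at this
      linarith
    have h2 : (2 : ℝ) ≤ 2 ^ (d + 1) := by
      calc (2 : ℝ) = 2 ^ 1 := by norm_num
        _ ≤ 2 ^ (d + 1) := pow_le_pow_right₀ (by norm_num) (by omega)
    rw [sub_nonneg, div_le_one hN]
    linarith
  have h2 : A ^ 2 ^ (d + 1) ≤ Real.exp (-(θ * n / 4 ^ (d + 1))) ^ 2 ^ (d + 1) := by
    calc A ^ 2 ^ (d + 1) ≤ (1 - θ / 2 ^ (d + 1)) ^ n := h
      _ ≤ Real.exp (-(θ / 2 ^ (d + 1))) ^ n := pow_le_pow_left₀ hbase0 hbase n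
      _ = Real.exp (-(θ * n / 4 ^ (d + 1))) ^ 2 ^ (d + 1) := by
          rw [← Real.exp_nat_mul, ← Real.exp_nat_mul]
          congr 1
          have h4 : (4 : ℝ) ^ (d + 1) = 2 ^ (d + 1) * 2 ^ (d + 1) := by
            rw [← mul_pow]; norm_num
          rw [h4]
          field_simp
          push_cast
          ring
  exact (pow_le_pow_iff_left₀ (norm_nonneg _) (Real.exp_nonneg _) (pow_ne_zero _ two_ne_zero)).1 h2

/-- For a unit complex number `u ≠ 1`, `Re u < 1`. [folklore] -/
private theorem re_lt_one_of_norm_one {u : ℂ} (hu : ‖u‖ = 1) (h1 : u ≠ 1) : u.re < 1 := by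
  have hle : u.re ≤ 1 := hu ▸ Complex.re_le_norm u
  rcases hle.lt_or_eq with h | h
  · exact h
  · exfalso
    apply h1
    have hsq : u.re ^ 2 + u.im ^ 2 = 1 := by
      have := Complex.sq_norm u
      rw [hu, Complex.normSq_apply] at this
      nlinarith [this]
    have him : u.im = 0 := by nlinarith [hsq, h]
    exact Complex.ext (by simp [h]) (by simp [him])

/-- **The base is `< 1` for roots of unity of odd order** (the hypothesis of VW08 Thm. 2.9: `m` odd,
`ζ = e_m(a)` with `a ≢ 0`): if `ζ^m = 1`, `m` odd, `ζ ≠ 1` then `ζ^(2^d) ≠ 1`, hence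
`Re ζ^(2^d) < 1` and `1 − (1 − Re ζ^(2^d))/2^(d+1) < 1`. [cite: ViolaWigderson2008, Theorem 2.9 (proof)] -/
theorem re_pow_lt_one_of_odd_order {ζ : ℂ} {m : ℕ} (hm : Odd m) (hζm : ζ ^ m = 1) (hζ1 : ζ ≠ 1)
    (d : ℕ) : (ζ ^ 2 ^ d).re < 1 := by
  have hnorm : ‖ζ‖ = 1 := by
    have hm0 : m ≠ 0 := by rintro rfl; exact (Nat.not_odd_zero hm).elim
    have := congrArg norm hζm
    rw [norm_pow, norm_one] at this
    exact (pow_eq_one_iff_of_nonneg (norm_nonneg _) hm0).1 this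
  refine re_lt_one_of_norm_one (by rw [norm_pow, hnorm, one_pow]) fun h => hζ1 ?_
  have hcop : Nat.Coprime (2 ^ d) m := (Nat.coprime_two_left.2 hm).pow_left d
  have := (pow_gcd_eq_one (a := ζ)).2 ⟨h, hζm⟩
  rwa [hcop.gcd_eq_one, pow_one] at this

end Bridge

end GowersCube

end Literature.Computability.MetaComplexity
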